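import Mathlib
import HarnessLib
import Literature.MathematicalPhysics.QuantumLattice.GaugeGroups
import Literature.MathematicalPhysics.QuantumFieldTheory.ConstructiveQFTWave0
import Literature.MathematicalPhysics.QuantumFieldTheory.UnitaryCayleyChart
import Summits.Ventures.LatticeQCDFlow.Scaling.BarriersTransport
import Summits.Ventures.LatticeQCDFlow.Scaling.ExactTransportBetween

/-!
# LatticeQCDFlow / Scaling — barrier supplement v2.7: the expansion law is charged per unit of COUPLING WINDOW

HONEST FRAMING: exact (Metropolis-corrected) sampling algorithms for lattice gauge theory;
figures of merit are autocorrelation/cost numbers at stated couplings and volumes; no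
continuum-physics claim.

THEORY-2.md §5.11 (theory seat GEN-12).  One PROVED supplement to `TransportExpansionLaw`
(`Scaling/BarriersTransport.lean`, v2.6), in the barrier-docstring format (`technique_class` · `blocks` ·
`because` · `evasions_known` · `scope_caveats` · `nearest_prior_art` · `status`): a `def … : Prop` immediately
DISCHARGED by the instances of `Scaling/ExactTransportBetween.lean`.  It closes the one scope caveat of the v2.6
entry ("between two couplings `β₀ < β` only the markdown form `log K ≥ c(β − β₀) − C` is asserted, not
formalised") and corrects its evasion (ii): a TAILED reference evades the expansion law, a COMPACT Gibbs prior
`μ_{Λ,β₀}` at any `0 ≤ β₀ < β` does not — the Lipschitz budget of an exact flow is charged per unit of coupling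
window `β − β₀`, uniformly in the volume.  `transportExpansionLaw_of_window` records that the window law contains
the v2.6 law (`β₀ = 0`).  The barrier NAMES of record (VolumeScalingOfTraining, TopologicalModeCollapse,
ExactnessVsExpressivity, FermionDeterminantCost) are unchanged; the literature named under `nearest_prior_art` is
CONTEXT found by search (THEORY-2.md §8 (40)), nothing is imported from it.
-/

noncomputable section

namespace Summit.Ventures.LatticeQCDFlow.Barriers

open scoped Matrix.Norms.Frobenius
open Literature.MathematicalPhysics.QuantumFieldTheory.UnitaryCayley (𝔾)
open Literature.MathematicalPhysics.QuantumLattice (u1Rep unitaryFundamentalRep fundamentalRep)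

/-- **Supplement (TransportWindowLaw) to TransportExpansionLaw / ExactnessVsExpressivity — the expansion
of an exact flow is charged per unit of COUPLING WINDOW, uniformly in the volume.**  For `G = U(1)` (chordal
metric), `G = U(N)`, `N ≥ 1`, and `G = SU(N)`, `N ≥ 2` (Hilbert–Schmidt metric), Wilson action in the defining
representation, `d ≥ 2`: there are `c > 0` and `C` such that for every `L ≥ 2`, every `0 ≤ β₀ ≤ β` and every
map `T : G^E → G^E` that is `K`-Lipschitz for the sup metric and EXACT BETWEEN THE TWO COUPLINGS,
`T_*μ_{Λ_L,β₀} = μ_{Λ_L,β}`, one has `K ≥ e^{c(β-β₀) - C}` (`c = 3s₀/(4κd)`, `κ = dim G`, `s₀` the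
extensive-action constant, `C = (log(A/a) + log(1/a) + κ log(1/r₀))/κ` from the two-sided Haar ball-volume
constants and the uniform low-action radius; no co-Lipschitz, injectivity or smoothness hypothesis).  A stack
of `n` layers, each `Λ`-Lipschitz, realising `μ_{β₀} → μ_β` exactly has `n·log Λ ≥ c(β-β₀) - C`
(`Theory2.Lattice.LayerExpansionDepthBetween`, `SUN.layerExpansionDepthBetween`), and a chain of exact stages
`β₀ < β₁ < ⋯ < β_n = β` has `Σᵢ log Lip(Tᵢ) ≥ log Lip(T_n ∘ ⋯ ∘ T₁) ≥ c(β-β₀) - C`: staging does not lower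
the total.
technique_class: deterministic exact flows BETWEEN COUPLINGS — one Lipschitz map, or a stack of any depth,
  pushing a thermalised `β₀`-ensemble (heat-bath / HMC output at `β₀`, or the output of an earlier flow) to
  `β > β₀`: `β`-matched continuous / trivializing flows read between two flow times (Lüscher's `t`-expansion;
  learned trivializing gradient flows; the continuous flows of Gerdes–de Haan–Bondesan–Cheng, PRD 2025 =
  arXiv:2410.13161, §IV: "match the flow time `t` with the target inverse temperature `β` as `β(t) = 9·t`"),
  coupling-transfer / retrained-conditional / correlated-ensemble flows, all read at accuracy `ε = 0`.
blocks: "starting the flow from a Gibbs prior at `β₀ > 0` instead of product Haar evades the `e^{cβ}`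
  expansion law" — it does not: `log Lip(T) ≥ c(β - β₀) - C`; for a `β`-matched continuous flow `Φ_{s→t}`
  generated by a vector field `v_τ` this reads (Grönwall) `∫_s^t Lip(v_τ) dτ ≥ c(β(t) - β(s)) - C` on every
  window — the generator cannot stay uniformly Lipschitz while `β(t)` grows without bound.
because: PROVED `Theory2.Lattice.U1.exactTransportExpansionBetween`, `….UN.exactTransportExpansionBetween`,
  `….SUN.exactTransportExpansionBetween` (`exactTransportExpansionBetween_of_ballVolumes`, three volume-uniform
  inequalities: STEP 1′ `log Z_β - log Z_{β₀} + β S(Tx) - β₀ S(x) ≤ #E(log(A/a) + κ log K)` at EVERY `x`;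
  the sublevel `Z`-ratio bound `log Z_β - log Z_{β₀} ≥ -(β-β₀)s₀L^d/4 + #E(log a + κ log r₀)` (Chebyshev's
  order inequality `π{S ≤ s}·Z_{β₀} ≤ W_{β₀}{S ≤ s}` + the low-action ball `B̄(1,r₀) ⊆ {S ≤ s₀L^d/4}`); and an
  image point `Tx` within `η` of the MAXIMUM of the action `S_max ≥ s₀L^d`, where
  `β S(Tx) - β₀ S(x) ≥ (β-β₀)S_max - βη`; the `L^d`'s match: `κd·log K ≥ (3/4)s₀(β-β₀) - d·C₁`).
evasions_known: (i) ε-ACCURACY — as for `TransportExpansionLaw` the law is an EXACTNESS ARTEFACT, driven by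
  the configurations within `η` of the action maximum (`μ_β`-mass `e^{-Θ(βL^d)}`); (ii) a TAILED (non-compact)
  reference measure (Gaussian / Lie-algebra prior), where the reference's tails supply the expansion
  (Bauerschmidt–Bodineau–Dagallier arXiv:2307.07619 Thm 6–7; Shenfeld arXiv:2205.01642) — but NOT a compact
  Gibbs prior at a smaller coupling (this entry); (iii) STOCHASTIC layers (NE-MCMC / stochastic normalizing
  flows between couplings) are not maps and pay in another currency, dissipated work: `n_step ∝ (L/a)⁴` at fixed
  KL or ESS and KL `∝ (β-β₀)²/n_step` for a linear protocol in 4-d `SU(3)` (Bulgarelli–Cellini–Nada, PRD 111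
  (2025) 074517 = arXiv:2412.00200, §4.2 and App. A; the tree's `Barriers.AnnealingStepLaw` /
  `nsteps_linProtocol_ge`).
scope_caveats: EXACT transport only (nothing is claimed about KL / ESS of an approximate flow); `0 ≤ β₀ ≤ β`
  only (no statement for flows towards SMALLER coupling); sup metric on `G^E`; `C` is not sharp — it is an
  artefact of the non-asymptotic ball-volume constants `A/a` and of the crude `Z`-ratio bound; the conjectured
  constant-free form `κ·#E·log Lip(T) ≥ (β-β₀)·(S_max - ⟨S⟩_{β₀})` is NOT typed.
nearest_prior_art: volume-uniform Lipschitz transport ALONG A SCALE PARAMETER for lattice `φ⁴` / sine-Gordon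
  from the Gaussian free field (arXiv:2307.07619 Thm 7, Ex. 10; arXiv:2205.01642) — the positive template with a
  tailed reference; empirical cost laws for stochastic flows between couplings in 4-d `SU(3)` (arXiv:2412.00200:
  steps linear in the volume, quadratic in the window) — a different currency; local Lipschitz blow-up of
  inverses of trained invertible networks (Behrmann–Vicol–Wang–Grosse–Jacobsen, AISTATS 2021 =
  arXiv:2006.09347) and the bi-Lipschitz topology obstruction (Cornish et al. arXiv:1909.13833 Thm 2.1) —
  separation-driven, volume- and coupling-free.  Searched (THEORY-2.md §8 (40), corpus fts+vec and galaxy):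
  no printed law charging the Lipschitz constant of an exact lattice-gauge transport to the coupling window.
status: PROVED (`transportWindowLaw`). -/
def TransportWindowLaw : Prop :=
  (∀ d : ℕ, 2 ≤ d → Theory2.Lattice.ExactTransportExpansionBetween d 1 Circle u1Rep) ∧
  (∀ d N : ℕ, 2 ≤ d → 1 ≤ N →
    @Theory2.Lattice.ExactTransportExpansionBetween d N (𝔾 N) _ Subtype.metricSpace
      Theory2.Lattice.UN.isTopologicalGroup_hs Theory2.Lattice.UN.compactSpace_hs _
      Theory2.Lattice.UN.borelSpace_hs (unitaryFundamentalRep (Fin N) ℂ)) ∧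
  (∀ d N : ℕ, 2 ≤ d → 2 ≤ N →
    @Theory2.Lattice.ExactTransportExpansionBetween d N (Matrix.specialUnitaryGroup (Fin N) ℂ) _
      Subtype.metricSpace Theory2.Lattice.SUN.isTopologicalGroup_hs Theory2.Lattice.SUN.compactSpace_hs _
      Theory2.Lattice.SUN.borelSpace_hs (fundamentalRep (Fin N)))

/-- Discharge of `TransportWindowLaw` by the three instances of `Scaling/ExactTransportBetween.lean`. -/
theorem transportWindowLaw : TransportWindowLaw :=
  ⟨Theory2.Lattice.U1.exactTransportExpansionBetween, Theory2.Lattice.UN.exactTransportExpansionBetween,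
    Theory2.Lattice.SUN.exactTransportExpansionBetween⟩

/-- **The window law contains the v2.6 expansion law** (`β₀ = 0`: `μ_{Λ,0}` is product Haar;
`Theory2.Lattice.exactTransportExpansion_of_between` componentwise). -/
theorem transportExpansionLaw_of_window (h : TransportWindowLaw) : TransportExpansionLaw :=
  ⟨fun d hd => Theory2.Lattice.exactTransportExpansion_of_between u1Rep (h.1 d hd),
    fun d N hd hN => @Theory2.Lattice.exactTransportExpansion_of_between N (𝔾 N) _ Subtype.metricSpace
      Theory2.Lattice.UN.isTopologicalGroup_hs Theory2.Lattice.UN.compactSpace_hs _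
      Theory2.Lattice.UN.borelSpace_hs (unitaryFundamentalRep (Fin N) ℂ) d (h.2.1 d N hd hN),
    fun d N hd hN => @Theory2.Lattice.exactTransportExpansion_of_between N
      (Matrix.specialUnitaryGroup (Fin N) ℂ) _ Subtype.metricSpace Theory2.Lattice.SUN.isTopologicalGroup_hs
      Theory2.Lattice.SUN.compactSpace_hs _ Theory2.Lattice.SUN.borelSpace_hs (fundamentalRep (Fin N)) d
      (h.2.2 d N hd hN)⟩

end Summit.Ventures.LatticeQCDFlow.Barriers

end
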